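/-
Copyright: lit-balaban Phase-2 proof seat p27 (gen 8).  Statement-level skeleton of a published paper; no proof claims beyond what the
kernel checks below.
-/
import Literature.MathematicalPhysics.QuantumFieldTheory.BalabanImbrieJaffe1984to88.BIJ85Ineq723Torus
import Literature.MathematicalPhysics.QuantumFieldTheory.BalabanImbrieJaffe1984to88.BIJ85Ineq723TorusDirichlet
import Literature.MathematicalPhysics.QuantumFieldTheory.BalabanImbrieJaffe1984to88.BIJ85Ineq434Torus

/-!
# `BalabanImbrieJaffe1984to88.BIJ85Ineq723TorusDirichletStep` — T. Bałaban, J. Imbrie, A. Jaffe, *Renormalization of the Higgs model: minimizers,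
propagators and the stability of mean field theory*, Commun. Math. Phys. **97** (1985) 299–329 [BalabanImbrieJaffe1985], p. 325, the second sentence
of **(7.2.3)**: *"In fact this inequality also holds for propagators with Dirichlet boundary conditions outside a domain Λ, uniformly in Λ"* — PROVED
WITH NO HYPOTHESIS on the tori of the series **FOR THE (4.3.3) PROPAGATOR OF RECORD**: the Gaussian of the actual Δ_k of (4.3.1) over the fields of the
series' V1 constraint subspace `δ(QB)δ_{Ax}(B)` (`BIJ85Prop521Torus.Wstep`: block averages zero and the CENTRED-tree axial gauge
`LatticeFieldCalculus.IsAxial` — the `W` of seat p30's (5.2.1)/(6.1.1)/[BalabanJaffe1986] (2.27) torus files) THAT VANISH ON THE BONDS NOT MEETING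
`Λ = B(Λ′₀)` (*"variables localized in Λ"*): `|C^{(k)}_Λ(b, b′)| ≤ Me^{−δ|b₋ − b′₋|_∞}` with ONE pair `(M, δ)` depending on `(d, L)` only — every torus,
every scale `k + 1 ≤ m + K`, EVERY `Λ′₀`; together with (4.3.3) itself (the Gaussian identity, `Z^{(k)}_Λ > 0`) on that subspace

statement-level skeleton of published theorems with citation tags; proofs where landed; nothing here is a claim about the Yang–Mills mass gap

PDF held: `paper:balaban1985-cmp97-bij-higgs-minimizers` (journal page = PDF page + 298); p. 325 [PDF 27] read from the materialised text
(`~/.lit/texts/paper-balaban1985-cmp97-bij-higgs-minimizers/p0027.txt` L28–32).  THE PRINTED TEXT (verbatim): *"The unit lattice propagator C^{(k)}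
also has exponential decay, |C^{(k)}_{μν}(x, y)| ≤ Me^{−δ|x−y|}, (7.2.3) for x, y ∈ T₁^{(k)}. This inequality follows from the bound (2.157) in [6II] and
from the general theorem on unit lattice operators in [7]. In fact this inequality also holds for propagators with Dirichlet boundary conditions
outside a domain Λ, uniformly in Λ."*  [6II] = [Balaban1984PropagatorsII] pp. 249–250: *"If we denote the remaining variables by B′, then we can write
B = CB′ … By the definition of C we have of course that CB′ = 0 outside Λ … C^{(k)}_Λ = C(C*Δ_kC)⁻¹C*. (2.156)"*; p. 245: *"We denote by Λ also a set of
bonds b such that at least one of the end-points b₋, b₊ belongs to Λ"*.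

CITATION HEADER (lean-in-tree rule).  Part of the lit-balaban TYPED SKELETON (HOME `run/shared/lean/pub/lit-balaban/`), Phase-2 seat p27 GEN 8 (unit
`lit-balaban-p27`; TAKING line HOME/STATUS.md 2026-08-21T20:29:53Z, free-target protocol G.5-34(d)); row **C1.Eq7.2.3** of `HOME/SKELETON.md` (owner
r15, referee ref-5) — its RESIDUAL after seat p09 gen 6's programme «(7.2.3) for the ACTUAL C^{(k)}»: file 3 `BIJ85Ineq723Torus` proved (7.2.3) for the
(4.3.3) propagator on `Wstep` on the whole torus and left the Dirichlet sentence open (its HONEST SCOPE (iii)); file 6 `BIJ85Ineq723TorusDirichlet`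
proved the Dirichlet sentence in BAŁABAN'S CORNER-ROOTED GAUGE (`WcornerLam = Wcorner ⊓ {B = 0 off the Λ-bonds}`) and left the centred-gauge analogue
open (its HONEST SCOPE (i): *"would need the support bookkeeping of file 3's regauging and is not claimed"*).  THIS FILE does that bookkeeping: the two
regaugings of file 3 (`axialize B = B − ∂(fluct B)` into the centred gauge, `cornerize B = B − ∂μ⁰_B` into the corner gauge) are BLOCK-LOCAL (p08's
`fluct_eq_zero_of_interior`; the corner staircases `Γ_{y,x}` stay in `B(y)`), hence preserve «localized in Λ» when Λ is a union of blocks; so file 3's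
Galerkin transport `C_{W₁} = T̂C_{W₂}T̂ᵀ` runs between the Λ-slices `W_Λ` (file 6) and `Wstep_Λ := Wstep ⊓ {B = 0 off the Λ-bonds}` (here), and file 3's
Λ-INDEPENDENT locality/row-sum bounds of `T̂` with the pub-balaban sandwich lemma carry file 6's uniform decay over.  Junction rows: **B6.Eq2.152-2.157**
(owner r03; pv09's `B6Cov2156TorusSubset.IsLam` — the Λ-bonds of the torus), **BJ.Def2.3/BJ.Eq2.28** (owner r16; seat p30 gen 8's
`BJ86FluctuationCovariance227Torus.covDir_torus`: [BalabanJaffe1986] (2.27) `C_Λ^{(n)}` on the tori is the (4.1.1)-shape second moment of `Wstep P k ⊓ Λ`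
for an ARBITRARY subspace `Λ` — `lamSub P k Λ′₀` below is the lattice instance «variables localized in Λ = B(Λ′₀)», and `WstepLam = Wstep ⊓ lamSub`
by definition).  Decls used BY NAME (nothing restated): file 3 `BIJ85Ineq723Torus.{axialize, axialize_apply, isAxial_axialize, axialize_sub_mem_orbitV1,
eq_of_isAxial_of_sub_mem_orbitV1, cornerFn, cornerFn0, cornerize, cornerize_sub_mem_orbitV1, toEj_cornerize_mem_Wcorner, regauge, regauge_toEj,
curlHop_regauge, regauge_mem_Wstep, noZeroModes_step, kernel_transport, regaugeMat, rowBound, rowBound_pos, supDist_le_of_regaugeMat_ne_zero,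
regaugeMat_row_le, idx_snd}`; file 6 `BIJ85Ineq723TorusDirichlet.{WcornerLam, mem_WcornerLam_iff, noZeroModes_cornerLam, ineq723_corner_dirichlet}`;
file 2 `BIJ85Ineq723TorusCornerGauge.{idx, idx_fst_coe, L_dvd_Mk, Wcorner}`; file 1 `BIJ85Eq431DeltaKBridge.{eta_pow_pos, Lpow_ne_zero}`; gen 2/3
`BIJ85UnitPropagator433.{unitPropagator, Hop, deltaOp, isUnitPropagator_unitPropagator}`, `BIJ85Ineq434Proof.axialPropagator_mem`; p30
`BIJ85Prop521Torus.{Wstep, mem_Wstep, toEj, QsE, CoarseSpace}`; p08 `BIJ85GaugeFunction5113.fluct`, `BIJ85GaugeFnBound513.fluct_eq_zero_of_interior`; r18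
`LatticeFieldCalculus.{siteAvg_eq_blockSum, gaugeShift, grad, supDist}`, `TorusGeometry`'s `Site.val_blockOf`; p16 `B5Eq112TorusCarriers.orbitV1`,
`B5Eq112RenormTransf.blockConst`; pub-balaban `B6Cov2156TorusSubset.{IsLam, inLam_iff_corner}`, `B6LowerBound2153Torus.{InLam, toT, rep, rep_toT,
rep_mem_pbox, rep_toT_eq_wrap}`, `B6Lemma24Torus.{pbox, block_subset_pbox, corner_mem_coarseSites, wrap}`, `B6BondElimination.{unitVec, contour,
contour_subset_treeBonds, mem_treeBonds, add_unitVec_mem_block}`, `B6Elimination.{corner, block, corner_eq_of_mem_block, mem_block_corner}`,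
`B6FromB4.sandwich_decay`, `B5Ineq137Torus.T_triangle`/`B3Bound323ZeroTorus.T_eq_supDist`/`B3TorusRadialSums.{supDist_eq_zero_iff, supDist_comm}`.

WHAT IS PROVED (kernel; `d ≥ 2` where [6II] (2.153) enters, standing range `k + 1 ≤ m + K`; physical normalisation `w = η^d`, `c = L^k`; `Λ′₀` an
ARBITRARY finite set of integer labels — the block corners selecting `Λ = B(Λ′₀)`):
* §0 THE DICTIONARY `Λ = B(Λ′₀)` ON `T₁^{(k)}`: `cornerOf x` (the `L`-lattice corner of the block of `x`), **`blockOf_eq_iff_cornerOf_eq`** (one V1 block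
  ⇔ one corner), `tgt_eq_toT`/`wrap_rep_add_unitVec` (the target of `⟨x, x + e_μ⟩` on the integer labels), **`isLam_idx_iff`** (pv09's Λ-bond predicate
  read on the V1 lattice: `b` meets `Λ` iff the corner of `b₋` or of `b₊` is in `Λ′₀`), `not_isLam_of_blockOf_eq`.
* §1 **`lamSub P k Λ′₀`** — the `T₁^{(k)}`-bond fields localized in `Λ` (a `Submodule` with body; `mem_lamSub_iff` = file 6's vanishing clause verbatim,
  **`mem_lamSub_iff_bond`**: `B = 0` on every bond with both end-points in blocks off `Λ`); **`WcornerLam_eq_inf`** (file 6's `W_Λ = Wcorner ⊓ lamSub`);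
  **`WstepLam P k Λ′₀ := Wstep ⊓ lamSub`** (`mem_WstepLam_iff`, `WstepLam_le`); the extreme cases `lamSub_eq_top`/`WstepLam_eq_Wstep` (`Λ ⊇ T₁^{(k)}`:
  file 3's torus subspace) and `lamSub_empty`/`WstepLam_empty` (`Λ = ∅`: the zero subspace).
* §2 BLOCK-LOCALITY OF THE TWO REGAUGINGS: `blockOf_toT_eq`, **`cornerFn_eq_zero_of_interior`**/`cornerFn0_eq_zero_of_interior` (the corner staircase
  functional `μ_B(x) = B(Γ_{y(x),x})` and `μ⁰_B` vanish when `B` vanishes on the bonds inside the block of `x`), `siteAvg_eq_zero_of_block`,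
  `vanish_block_of_mem_lamSub`; **`regauge_mem_WstepLam`** (`T̂(W_Λ) ⊆ Wstep_Λ`), **`cornerize_mem_WcornerLam`**, `regauge_cornerize` (file 3's onto-witness
  made explicit), **`exists_regauge_eq_lam`** (`T̂ : W_Λ → Wstep_Λ` ONTO).
* §3 (4.3.3) WITH DIRICHLET BOUNDARY CONDITIONS ON `Wstep_Λ`: **`noZeroModes_stepLam`**, **`unitPropagator_stepLam_wellDefined`** (the Gaussian identity
  `IsUnitPropagator (WstepLam P k Λ′₀) Δ_k C^{(k)}_Λ` and `Z^{(k)}_Λ > 0`, every `Λ′₀`, no hypothesis), `unitPropagator_stepLam_mem` (`C^{(k)}_ΛJ` is localized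
  in `Λ`), `KcornerLam` (file 6's kernel as a matrix), **`kernel_stepLam_eq`** (`C_{Wstep_Λ}(b, b′) = (T̂ · K_Λ · T̂ᵀ)(b, b′)`).
* §4 **(7.2.3) WITH DIRICHLET BOUNDARY CONDITIONS, UNIFORMLY IN Λ, FOR THE PROPAGATOR OF RECORD, NO HYPOTHESIS**: **`ineq723_step_dirichlet`** — ∃ `M, δ > 0`
  depending on `(d, L)` ONLY with `|C^{(k)}_Λ(b, b′)| ≤ Me^{−δ·supDist(b₋, b′₋)}` for every torus of these `(d, L)`, every `k + 1 ≤ m + K`, EVERY `Λ′₀`, all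
  bonds (`M = M₂e^{2δ₂L}(rowBound d L)²`, `δ = δ₂` from file 6); `ineq723_step_dirichlet_and_torus` (the same pair also bounds file 3's propagator on
  `Wstep`, via `WstepLam_eq_Wstep`).
* §5 (v1.1) **(2.153) AND (4.3.4) WITH DIRICHLET BOUNDARY CONDITIONS, UNIFORMLY IN Λ** (p09 gen 6's `BIJ85Ineq434Torus.coercive_step'` on `Wstep`
  restricted to `Wstep_Λ ⊆ Wstep`): `coercive_stepLam'`/**`coercive_stepLam`** (`(γ₁/R²)‖B‖² ≤ ⟨B, Δ_kB⟩` on `Wstep_Λ`, `γ₁ = (1/12d²)L^{−d−1}`,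
  `R = rowBound d L`), **`norm_unitPropagator_stepLam_le`** (`‖C^{(k)}_ΛJ‖ ≤ (R²/γ₁)‖J‖`, `0 ≤ ⟨J, C^{(k)}_ΛJ⟩ ≤ (R²/γ₁)‖J‖²` — p. 311 *"bounded in norm
  ‖C^{(k)}‖ ≤ c (4.3.4) uniformly in k"*, here also uniformly in Λ: ONE `c` from `(d, L)` for every `Λ′₀`), `opNorm_unitPropagator_stepLam_le`.
HONEST SCOPE.  (i) "Dirichlet boundary conditions outside Λ" is read, as on [6II] p. 250 and in [BalabanJaffe1986] (2.27), as the Gaussian (4.3.3) over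
the constrained fields vanishing on every bond with no end-point in `Λ = B(Λ′₀)` (modulo the periods; pv09's `IsLam`) — here in the series' own centred
gauge `Wstep`, so that `C^{(k)}_Λ` at `Λ ⊇ T₁^{(k)}` IS the (4.3.3) propagator of record of file 3 / p11's `CE` / p30's (2.27) `cov_torus`.  (ii) `Λ` is
a union of BLOCKS (`Λ = B(Λ′₀)`, as printed in [6II]); a domain that is not a union of blocks is not covered (the regaugings are block-local, not
bond-local).  (iii) Torus, U = 1, real abelian fields, `d ≥ 2`; the standing range `k + 1 ≤ m + K` is that of files 3 and 6.  (iv) Constants: existential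
`(M₂, δ₂)` from file 6 (pv09's engine), `rowBound` explicit; no optimality claimed; the uniformity in `k`, in the volume AND in `Λ` printed on p. 325 IS
proved (constants chosen from `(d, L)` before the torus, the scale and `Λ′₀`).  (v) (4.3.4) on `Wstep_Λ` (§5, v1.1) carries p09's constant `R²/γ₁` (file `BIJ85Ineq434Torus`'s honest scope: `R²` versus the printed
`(γ₀/12d²)L^{−d−1}` of [6II] (2.153), an artefact of the regauging route).  (vi) Four `def`s with
bodies (`cornerOf`, `lamSub`, `WstepLam`, `KcornerLam`; one private pseudo-metric structure copied from file 3, where it is private), no `def … : Prop`,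
no new named fact (D-0026).  Unit `lit-balaban-p27` (literature-prover-lit-balaban-p27-g8-0), 2026-08-21.
-/

namespace Literature.MathematicalPhysics.QuantumFieldTheory.BalabanImbrieJaffe1984to88.BIJ85Ineq723TorusDirichletStep

open Literature.MathematicalPhysics.QuantumFieldTheory.Balaban1983to89
open scoped BigOperators Matrix RealInnerProductSpace
open LatticeFieldCalculus
open BIJ85AxialPropagator411 (curlOp V411 axialPropagator)
open BIJ85UnitPropagator433 (Hop deltaOp unitPropagator)
open BIJ85Prop521Torus (CoarseSpace toEj QsE Wstep mem_Wstep)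
open BIJ85GaugeFunction5113 (fluct)
open BIJ85GaugeFnBound513 (fluct_eq_zero_of_interior)
open BIJ85Eq431DeltaKBridge (eta_pow_pos Lpow_ne_zero)
open BIJ85Ineq723TorusCornerGauge (L_dvd_Mk idx idx_fst_coe idx_symm_apply Wcorner mem_Wcorner_iff)
open BIJ85Ineq723Torus (idx_snd supDist_le_of_blockOf_eq supDist_tgt_le axialize axialize_apply isAxial_axialize axialize_sub_mem_orbitV1
  eq_of_isAxial_of_sub_mem_orbitV1 cornerFn cornerFn0 cornerize cornerize_sub_mem_orbitV1 toEj_cornerize_mem_Wcorner regauge regauge_apply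
  regauge_toEj curlHop_regauge regauge_mem_Wstep regaugeMat rowBound rowBound_pos supDist_le_of_regaugeMat_ne_zero regaugeMat_row_le
  kernel_transport)
open BIJ85Ineq723TorusDirichlet (WcornerLam WcornerLam_le eq_zero_of_mem_WcornerLam mem_WcornerLam_iff noZeroModes_cornerLam
  ineq723_corner_dirichlet)
open BIJ85Ineq434Torus (coercive_step')
open B6Cov2156TorusDelK (gamma2153one gamma2153one_pos)
open B5Eq112TorusCarriers (orbitV1)
open B5Eq112RenormTransf (blockConst)
open B5Eq117TorusCarriers (Mk)
open B6Lemma24Torus (pbox coarseSites block_subset_pbox corner_mem_coarseSites wrap_eq_self)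
open B6BondElimination (unitVec mem_contour contour_subset_treeBonds mem_treeBonds add_unitVec_mem_block)
open B6LowerBound2153Torus (toT rep rep_toT toT_rep rep_mem_pbox rep_toT_eq_wrap InLam)
open B6Cov2156TorusSubset (IsLam inLam_iff_corner)

noncomputable section

variable {P : Params} {k : ℕ}

/-! ## §0  The dictionary `Λ = B(Λ′₀)` on `T₁^{(k)}`: block corners of the integer labels vs. the V1 block map `blockOf` -/

/-- the corner (an `L`-lattice integer label) of the block of a site of `T₁^{(k)}`: `y(x) = L·⌊rep x / L⌋`. [cite: Balaban1984PropagatorsI, (1.6) p.18] -/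
def cornerOf (x : Balaban1983to89.Site P k) : Fin P.d → ℤ := B6Elimination.corner P.L (rep (Mk P k) x)

/-- unfolding `cornerOf`. [cite: Balaban1984PropagatorsI, (1.6) p.18] -/
theorem cornerOf_def (x : Balaban1983to89.Site P k) : cornerOf x = B6Elimination.corner P.L (rep (Mk P k) x) := rfl

/-- **two sites lie in one V1 block iff their integer labels have the same block corner** (`blockOf` = integer division of the labels by `L`,
standing range). [cite: Balaban1987RG1, (0.1) p.252] -/
theorem blockOf_eq_iff_cornerOf_eq (hk : k + 1 ≤ P.m + P.K) (x z : Balaban1983to89.Site P k) :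
    blockOf x = blockOf z ↔ cornerOf x = cornerOf z := by
  have hL0 : (P.L : ℤ) ≠ 0 := by exact_mod_cast P.L_pos.ne'
  constructor
  · intro h
    funext i
    have hq : (x i).val / P.L = (z i).val / P.L := by
      rw [← Balaban1983to89.Site.val_blockOf hk x i, ← Balaban1983to89.Site.val_blockOf hk z i, h]
    simp only [cornerOf, B6Elimination.corner_apply, rep]
    rw [← Int.natCast_div, ← Int.natCast_div, hq]
  · intro h
    funext i
    apply ZMod.val_injective
    rw [Balaban1983to89.Site.val_blockOf hk, Balaban1983to89.Site.val_blockOf hk]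
    have h2 := congr_fun h i
    simp only [cornerOf, B6Elimination.corner_apply, rep] at h2
    have h3 := mul_left_cancel₀ hL0 h2
    rw [← Int.natCast_div, ← Int.natCast_div] at h3
    exact_mod_cast h3

/-- the target of a bond `⟨x, x + e_μ⟩` is `(rep x + e_μ) mod M`. [cite: Balaban1984PropagatorsII, (2.152) p.249] -/
theorem tgt_eq_toT (b : PBond P k) : b.tgt = toT (Mk P k) (rep (Mk P k) b.src + unitVec b.dir) := by
  funext i
  by_cases hi : i = b.dir
  · subst hi
    rw [PBond.tgt, Balaban1983to89.Site.shift, Function.update_self]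
    simp only [toT, Pi.add_apply, B6BondElimination.unitVec_apply, rep, if_true, Int.cast_add, Int.cast_natCast,
      Int.cast_one, ZMod.natCast_zmod_val]
  · rw [PBond.tgt, Balaban1983to89.Site.shift, Function.update_of_ne hi]
    simp only [toT, Pi.add_apply, B6BondElimination.unitVec_apply, rep, if_neg hi, add_zero, Int.cast_natCast,
      ZMod.natCast_zmod_val]

/-- `wrap (rep x + e_μ) = rep (x + e_μ)`. [cite: Balaban1984PropagatorsII, (2.152) p.249] -/
theorem wrap_rep_add_unitVec (b : PBond P k) :
    B6Lemma24Torus.wrap (Mk P k) (rep (Mk P k) b.src + unitVec b.dir) = rep (Mk P k) b.tgt := by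
  rw [← rep_toT_eq_wrap, ← tgt_eq_toT]

/-- **THE Λ-BONDS OF `T₁^{(k)}`** (pv09's `IsLam`, [6II] p. 245 *"a set of bonds b such that at least one of the end-points b₋, b₊ belongs to Λ"*)
READ ON THE V1 LATTICE: the bond `b` meets `Λ = B(Λ′₀)` iff the block corner of `b₋` or of `b₊` is in `Λ′₀`. [cite: Balaban1984PropagatorsII, Lemma 2.4 p.245] -/
theorem isLam_idx_iff (Λ'₀ : Finset (Fin P.d → ℤ)) (b : PBond P k) :
    IsLam P.L (Mk P k) Λ'₀ (idx P k b) ↔ cornerOf b.src ∈ Λ'₀ ∨ cornerOf b.tgt ∈ Λ'₀ := by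
  unfold IsLam
  rw [idx_fst_coe, inLam_iff_corner (rep_mem_pbox (Mk P k) b.src)]
  show _ ∨ InLam P.L (Mk P k) Λ'₀ (rep (Mk P k) b.src + unitVec (idx P k b).2) ↔ _
  rw [idx_snd, InLam, wrap_rep_add_unitVec]
  rfl

/-- a bond with both end-points in the block of a site `x` whose block is not a block of `Λ` is not a Λ-bond. [cite: Balaban1984PropagatorsII, p.245] -/
theorem not_isLam_of_blockOf_eq (hk : k + 1 ≤ P.m + P.K) {Λ'₀ : Finset (Fin P.d → ℤ)} {x : Balaban1983to89.Site P k}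
    (hx : cornerOf x ∉ Λ'₀) {b : PBond P k} (hs : blockOf b.src = blockOf x) (ht : blockOf b.tgt = blockOf x) :
    ¬ IsLam P.L (Mk P k) Λ'₀ (idx P k b) := by
  rw [isLam_idx_iff, (blockOf_eq_iff_cornerOf_eq hk _ _).1 hs, (blockOf_eq_iff_cornerOf_eq hk _ _).1 ht, or_self]
  exact hx

/-! ## §1  «variables localized in Λ»: the subspace of `T₁^{(k)}`-bond fields vanishing on the bonds not meeting `Λ`, and `WstepLam` -/

/-- **THE FIELDS LOCALIZED IN `Λ = B(Λ′₀)`** ([6II] p. 250 *"CB′ = 0 outside Λ"*; [BalabanJaffe1986] (2.27) *"variables localized in Λ"*): the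
`T₁^{(k)}`-bond fields vanishing on every bond not meeting `Λ` (pv09's `IsLam`, modulo the periods), a subspace of `CoarseSpace P k`.
[cite: Balaban1984PropagatorsII, (2.152)–(2.156) pp.249–250; BalabanImbrieJaffe1985, (7.2.3) p.325] -/
def lamSub (P : Params) (k : ℕ) (Λ'₀ : Finset (Fin P.d → ℤ)) : Submodule ℝ (CoarseSpace P k) where
  carrier := {B | ∀ p, ¬ IsLam P.L (Mk P k) Λ'₀ p → B ((idx P k).symm p) = 0}
  zero_mem' := fun _ _ => rfl
  add_mem' := fun {B B'} hB hB' p hp => by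
    show B ((idx P k).symm p) + B' ((idx P k).symm p) = 0
    rw [hB p hp, hB' p hp, add_zero]
  smul_mem' := fun c {B} hB p hp => by
    show c * B ((idx P k).symm p) = 0
    rw [hB p hp, mul_zero]

variable {Λ'₀ : Finset (Fin P.d → ℤ)}

/-- membership in `lamSub`, on the variables of the box. [cite: Balaban1984PropagatorsII, p.250] -/
theorem mem_lamSub_iff (B : CoarseSpace P k) : B ∈ lamSub P k Λ'₀ ↔ ∀ p, ¬ IsLam P.L (Mk P k) Λ'₀ p → B ((idx P k).symm p) = 0 :=
  Iff.rfl

/-- **membership in `lamSub`, on the bonds of `T₁^{(k)}`**: `B = 0` on every bond whose two end-points lie in blocks not in `Λ`.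
[cite: Balaban1984PropagatorsII, p.250] -/
theorem mem_lamSub_iff_bond (B : CoarseSpace P k) :
    B ∈ lamSub P k Λ'₀ ↔ ∀ b : PBond P k, cornerOf b.src ∉ Λ'₀ → cornerOf b.tgt ∉ Λ'₀ → B b = 0 := by
  rw [mem_lamSub_iff]
  constructor
  · intro h b hs ht
    have h1 := h (idx P k b) (by rw [isLam_idx_iff]; push Not; exact ⟨hs, ht⟩)
    rwa [Equiv.symm_apply_apply] at h1
  · intro h p hp
    rw [← (idx P k).apply_symm_apply p, isLam_idx_iff] at hp
    push Not at hp
    exact h _ hp.1 hp.2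

/-- a field localized in `Λ` vanishes at a non-Λ bond. [cite: Balaban1984PropagatorsII, p.250] -/
theorem eq_zero_of_mem_lamSub {B : CoarseSpace P k} (hB : B ∈ lamSub P k Λ'₀) {b : PBond P k} (hb : ¬ IsLam P.L (Mk P k) Λ'₀ (idx P k b)) :
    B b = 0 := by
  have h := hB (idx P k b) hb
  rwa [Equiv.symm_apply_apply] at h

/-- **`W_Λ = Wcorner ⊓ lamSub`**: file 6's Λ-constraint subspace of Bałaban's corner gauge IS the corner-gauge subspace met with the fields localized
in `Λ` (file 6's `mem_WcornerLam_iff`). [cite: Balaban1984PropagatorsII, (2.154)–(2.155) pp.249–250] -/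
theorem WcornerLam_eq_inf (hk : k + 1 ≤ P.m + P.K) : WcornerLam P k Λ'₀ = Wcorner P k ⊓ lamSub P k Λ'₀ := by
  ext B
  rw [Submodule.mem_inf, mem_WcornerLam_iff hk, mem_lamSub_iff]

/-- **THE CONSTRAINT SUBSPACE OF (4.3.3) WITH DIRICHLET BOUNDARY CONDITIONS OUTSIDE `Λ`, IN THE V1 GAUGE OF RECORD**: `δ(QB)δ_{Ax}(B)` (`Wstep`:
block averages zero, CENTRED-tree axial gauge) met with the fields localized in `Λ = B(Λ′₀)`. [cite: BalabanImbrieJaffe1985, (4.3.3) p.311, (7.2.3) p.325] -/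
def WstepLam (P : Params) (k : ℕ) (Λ'₀ : Finset (Fin P.d → ℤ)) : Submodule ℝ (CoarseSpace P k) := Wstep P k ⊓ lamSub P k Λ'₀

/-- unfolding `WstepLam`. [cite: BalabanImbrieJaffe1985, (4.3.3) p.311] -/
theorem WstepLam_def : WstepLam P k Λ'₀ = Wstep P k ⊓ lamSub P k Λ'₀ := rfl

/-- membership in `WstepLam`. [cite: BalabanImbrieJaffe1985, (4.3.3) p.311] -/
theorem mem_WstepLam_iff (B : CoarseSpace P k) : B ∈ WstepLam P k Λ'₀ ↔ B ∈ Wstep P k ∧ B ∈ lamSub P k Λ'₀ := Submodule.mem_inf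

/-- `WstepLam ⊆ Wstep`. [cite: BalabanImbrieJaffe1985, (4.3.3) p.311] -/
theorem WstepLam_le : WstepLam P k Λ'₀ ≤ Wstep P k := inf_le_left

/-- the extreme case `Λ ⊇ T₁^{(k)}`: every field is localized in `Λ`. [cite: Balaban1984PropagatorsII, p.250] -/
theorem lamSub_eq_top (h : ∀ x : Balaban1983to89.Site P k, cornerOf x ∈ Λ'₀) : lamSub P k Λ'₀ = ⊤ :=
  eq_top_iff.2 fun B _ => (mem_lamSub_iff_bond B).2 fun b hs _ => absurd (h b.src) hs

/-- the extreme case `Λ ⊇ T₁^{(k)}`: `Wstep_Λ = Wstep`, the (4.3.3) subspace of the whole torus (file 3). [cite: BalabanImbrieJaffe1985, (4.3.3) p.311] -/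
theorem WstepLam_eq_Wstep (h : ∀ x : Balaban1983to89.Site P k, cornerOf x ∈ Λ'₀) : WstepLam P k Λ'₀ = Wstep P k := by
  rw [WstepLam_def, lamSub_eq_top h, inf_top_eq]

/-- the extreme case `Λ = ∅`: only the zero field is localized in `∅`. [cite: Balaban1984PropagatorsII, p.250] -/
theorem lamSub_empty : lamSub P k (∅ : Finset (Fin P.d → ℤ)) = ⊥ :=
  eq_bot_iff.2 fun B hB => (Submodule.mem_bot ℝ).2 (by
    ext b
    exact ((mem_lamSub_iff_bond B).1 hB) b (Finset.notMem_empty _) (Finset.notMem_empty _))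

/-- the extreme case `Λ = ∅`: `Wstep_∅ = 0` (the bound (7.2.3) is then trivial). [cite: BalabanImbrieJaffe1985, (4.3.3) p.311] -/
theorem WstepLam_empty : WstepLam P k (∅ : Finset (Fin P.d → ℤ)) = ⊥ := by
  rw [WstepLam_def, lamSub_empty, inf_bot_eq]

/-! ## §2  Block-locality of the two regaugings: `T̂(W_Λ) ⊆ Wstep_Λ` and `T̂ : W_Λ → Wstep_Λ` is onto -/

/-- the sites of the integer block `B(y(x))` are the sites of the V1 block of `x`. [cite: Balaban1984PropagatorsI, (1.6) p.18] -/
theorem blockOf_toT_eq (hk : k + 1 ≤ P.m + P.K) (x : Balaban1983to89.Site P k) {z : Fin P.d → ℤ}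
    (hz : z ∈ B6Elimination.block P.L (cornerOf x)) : blockOf (toT (Mk P k) z) = blockOf x := by
  have hL := P.L_pos
  have hzb : z ∈ pbox (Mk P k) := block_subset_pbox (L_dvd_Mk hk) (corner_mem_coarseSites hL (rep_mem_pbox (Mk P k) x)) hz
  rw [blockOf_eq_iff_cornerOf_eq hk, cornerOf_def (toT (Mk P k) z), rep_toT (Mk P k) hzb]
  exact B6Elimination.corner_eq_of_mem_block hL hz

/-- **block-locality of the corner staircase functional**: `μ_B(x) = B(Γ_{y(x),x})` vanishes if `B` vanishes on the bonds with both end-points in the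
block of `x` (the staircase `Γ_{y,x}` stays in `B(y)`). [cite: Balaban1984PropagatorsI, (1.7) p.18] -/
theorem cornerFn_eq_zero_of_interior (hk : k + 1 ≤ P.m + P.K) (A : VecField P k ℝ) (x : Balaban1983to89.Site P k)
    (hA : ∀ b : PBond P k, blockOf b.src = blockOf x → blockOf b.tgt = blockOf x → A b = 0) : cornerFn A x = 0 := by
  unfold cornerFn
  refine Finset.sum_eq_zero fun e he => ?_
  have hL := P.L_pos
  have hx : rep (Mk P k) x ∈ B6Elimination.block P.L (cornerOf x) := B6Elimination.mem_block_corner hL _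
  have ht := mem_treeBonds.1 (contour_subset_treeBonds hx he)
  obtain ⟨he1, -, he3⟩ := ht
  have he2 : e.1 + unitVec e.2 ∈ B6Elimination.block P.L (cornerOf x) := add_unitVec_mem_block he1 he3
  have hzb : e.1 ∈ pbox (Mk P k) := block_subset_pbox (L_dvd_Mk hk) (corner_mem_coarseSites hL (rep_mem_pbox (Mk P k) x)) he1
  apply hA
  · exact blockOf_toT_eq hk x he1
  · rw [tgt_eq_toT]
    show blockOf (toT (Mk P k) (rep (Mk P k) (toT (Mk P k) e.1) + unitVec e.2)) = blockOf x
    rw [rep_toT (Mk P k) hzb]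
    exact blockOf_toT_eq hk x he2

/-- a block average vanishes if the function vanishes on the block. [cite: Balaban1984PropagatorsI, (1.13) p.19] -/
theorem siteAvg_eq_zero_of_block (hk : k + 1 ≤ P.m + P.K) {f : SiteField P k ℝ} (y : Balaban1983to89.Site P (k + 1))
    (h : ∀ x, blockOf x = y → f x = 0) : siteAvg f y = 0 := by
  rw [siteAvg_eq_blockSum hk]
  have h0 : ∑ x ∈ Balaban1983to89.block y, f x = 0 :=
    Finset.sum_eq_zero fun x hx => by
      unfold Balaban1983to89.block at hx
      exact h x (Finset.mem_filter.1 hx).2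
  rw [h0, smul_zero]

/-- **block-locality of `μ⁰_B`** (the corner gauge function with its block mean removed). [cite: Balaban1984PropagatorsI, (1.13) p.19] -/
theorem cornerFn0_eq_zero_of_interior (hk : k + 1 ≤ P.m + P.K) (A : VecField P k ℝ) (x : Balaban1983to89.Site P k)
    (hA : ∀ b : PBond P k, blockOf b.src = blockOf x → blockOf b.tgt = blockOf x → A b = 0) : cornerFn0 A x = 0 := by
  have h1 : cornerFn A x = 0 := cornerFn_eq_zero_of_interior hk A x hA
  have h2 : siteAvg (cornerFn A) (blockOf x) = 0 :=
    siteAvg_eq_zero_of_block hk (blockOf x) fun z hz => cornerFn_eq_zero_of_interior hk A z fun b hs ht => hA b (hs.trans hz) (ht.trans hz)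
  simp only [cornerFn0, Pi.sub_apply, blockConst, h1, h2, sub_zero]

/-- the bonds inside a block off `Λ` are non-Λ bonds, so a field localized in `Λ` vanishes there. [cite: Balaban1984PropagatorsII, p.250] -/
theorem vanish_block_of_mem_lamSub (hk : k + 1 ≤ P.m + P.K) {B : CoarseSpace P k} (hB : B ∈ lamSub P k Λ'₀)
    {x : Balaban1983to89.Site P k} (hx : cornerOf x ∉ Λ'₀) :
    ∀ b : PBond P k, blockOf b.src = blockOf x → blockOf b.tgt = blockOf x → (toEj P k).symm B b = 0 :=
  fun _ hs ht => eq_zero_of_mem_lamSub hB (not_isLam_of_blockOf_eq hk hx hs ht)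

/-- **`T̂(W_Λ) ⊆ Wstep_Λ`**: the centred regauging `T̂B = B − ∂λ_B` of a corner-gauge field localized in `Λ` is localized in `Λ` — `λ_B = fluct B` is
block-local (p08's `fluct_eq_zero_of_interior`), so `∂λ_B` vanishes on a bond whose end-points lie in blocks off `Λ`.
[cite: BalabanImbrieJaffe1985, (7.2.4) p.326] -/
theorem regauge_mem_WstepLam (hk : k + 1 ≤ P.m + P.K) (v : WcornerLam P k Λ'₀) : regauge P k (v : CoarseSpace P k) ∈ WstepLam P k Λ'₀ := by
  obtain ⟨hW, hΛ⟩ := (mem_WcornerLam_iff hk (v : CoarseSpace P k)).1 v.2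
  have hΛ' : (v : CoarseSpace P k) ∈ lamSub P k Λ'₀ := hΛ
  refine (mem_WstepLam_iff _).2 ⟨regauge_mem_Wstep hk ⟨(v : CoarseSpace P k), hW⟩, (mem_lamSub_iff_bond _).2 fun b hs ht => ?_⟩
  show axialize ((toEj P k).symm (v : CoarseSpace P k)) b = 0
  rw [axialize_apply, fluct_eq_zero_of_interior hk b.tgt (vanish_block_of_mem_lamSub hk hΛ' ht),
    fluct_eq_zero_of_interior hk b.src (vanish_block_of_mem_lamSub hk hΛ' hs)]
  have h0 : (toEj P k).symm (v : CoarseSpace P k) b = 0 := ((mem_lamSub_iff_bond _).1 hΛ') b hs ht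
  rw [h0]; ring

/-- **the corner regauging of a `Wstep`-field localized in `Λ` is localized in `Λ`** (`μ⁰_B` is block-local). [cite: Balaban1984PropagatorsI, (1.10) p.19] -/
theorem cornerize_mem_WcornerLam (hk : k + 1 ≤ P.m + P.K) (w : WstepLam P k Λ'₀) :
    toEj P k (cornerize ((toEj P k).symm (w : CoarseSpace P k))) ∈ WcornerLam P k Λ'₀ := by
  obtain ⟨hW, hΛ⟩ := (mem_WstepLam_iff _).1 w.2
  obtain ⟨hQ, -⟩ := (mem_Wstep k (w : CoarseSpace P k)).1 hW
  rw [WcornerLam_eq_inf hk, Submodule.mem_inf]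
  refine ⟨toEj_cornerize_mem_Wcorner hk hQ, (mem_lamSub_iff_bond _).2 fun b hs ht => ?_⟩
  show cornerize ((toEj P k).symm (w : CoarseSpace P k)) b = 0
  have h0 : (toEj P k).symm (w : CoarseSpace P k) b = 0 := ((mem_lamSub_iff_bond _).1 hΛ) b hs ht
  simp only [cornerize, gaugeShift, grad, one_smul, h0,
    cornerFn0_eq_zero_of_interior hk _ b.tgt (vanish_block_of_mem_lamSub hk hΛ ht),
    cornerFn0_eq_zero_of_interior hk _ b.src (vanish_block_of_mem_lamSub hk hΛ hs), sub_self]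

/-- `T̂` of the corner regauging of a `Wstep`-field is the field (the two axial gauges are two slices of the same residual orbits; file 3's
`exists_regauge_eq`, witness made explicit). [cite: Balaban1984PropagatorsI, (1.13) p.19] -/
theorem regauge_cornerize (hk : k + 1 ≤ P.m + P.K) {w : CoarseSpace P k} (hw : w ∈ Wstep P k) :
    regauge P k (toEj P k (cornerize ((toEj P k).symm w))) = w := by
  obtain ⟨-, hAx⟩ := (mem_Wstep k w).1 hw
  rw [regauge_toEj]
  have h : axialize (cornerize ((toEj P k).symm w)) = (toEj P k).symm w := by
    refine eq_of_isAxial_of_sub_mem_orbitV1 hk (isAxial_axialize hk _) hAx ?_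
    have h1 := (orbitV1 P k).add_mem (axialize_sub_mem_orbitV1 hk (cornerize ((toEj P k).symm w)))
      (cornerize_sub_mem_orbitV1 hk ((toEj P k).symm w))
    rwa [sub_add_sub_cancel] at h1
  rw [h, LinearEquiv.apply_symm_apply]

/-- **`T̂ : W_Λ → Wstep_Λ` IS ONTO**. [cite: Balaban1984PropagatorsI, (1.13) p.19] -/
theorem exists_regauge_eq_lam (hk : k + 1 ≤ P.m + P.K) (w : WstepLam P k Λ'₀) :
    ∃ v : WcornerLam P k Λ'₀, regauge P k (v : CoarseSpace P k) = (w : CoarseSpace P k) :=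
  ⟨⟨_, cornerize_mem_WcornerLam hk w⟩, regauge_cornerize hk (WstepLam_le w.2)⟩

/-! ## §3  (4.3.3) WITH DIRICHLET BOUNDARY CONDITIONS ON `Wstep_Λ`: no zero modes, the Gaussian identity, the (2.156)-transport of the kernel -/

/-- **no zero modes of `∂H_{k,Ax}` on `Wstep_Λ`** (`⊆ Wstep`, file 3's `noZeroModes_step`); `d ≥ 2`, `k + 1 ≤ m + K`, every `Λ′₀`.
[cite: BalabanImbrieJaffe1985, (4.3.4) p.311] -/
theorem noZeroModes_stepLam (hd : 2 ≤ P.d) (hk : k + 1 ≤ P.m + P.K) (w : WstepLam P k Λ'₀)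
    (hw : curlOp (P := P) (P.eta k ^ P.d) ((P.L : ℝ) ^ k)
      (Hop (V411 P k) (curlOp (P := P) (P.eta k ^ P.d) ((P.L : ℝ) ^ k)) (QsE P k) (w : CoarseSpace P k)) = 0) : w = 0 := by
  have h := BIJ85Ineq723Torus.noZeroModes_step hd hk ⟨(w : CoarseSpace P k), WstepLam_le w.2⟩ hw
  have h1 := congrArg Subtype.val h
  rw [Submodule.coe_zero] at h1
  exact (Submodule.coe_eq_zero (x := w)).1 h1

/-- **(4.3.3) WITH DIRICHLET BOUNDARY CONDITIONS OUTSIDE `Λ` HOLDS FOR THE OPERATOR FORMULA ON `Wstep_Λ`, and `Z^{(k)}_Λ > 0`** — the Gaussian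
source identity `exp(½⟨J, C^{(k)}_ΛJ⟩) = (Z^{(k)}_Λ)⁻¹∫_{Wstep_Λ} exp(−½⟨B, Δ_kB⟩ + ⟨B, J⟩)dB` (gen 2's `isUnitPropagator_unitPropagator` with its
no-zero-modes hypothesis discharged), on the tori, EVERY `Λ′₀`, no hypothesis (`d ≥ 2`, `k + 1 ≤ m + K`).
[cite: BalabanImbrieJaffe1985, (4.3.3) p.311, (7.2.3) p.325] -/
theorem unitPropagator_stepLam_wellDefined (hd : 2 ≤ P.d) (hk : k + 1 ≤ P.m + P.K) :
    BIJ85UnitPropagator433.IsUnitPropagator (WstepLam P k Λ'₀)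
        (deltaOp (V411 P k) (curlOp (P := P) (P.eta k ^ P.d) ((P.L : ℝ) ^ k)) (QsE P k))
        (unitPropagator (V411 P k) (curlOp (P := P) (P.eta k ^ P.d) ((P.L : ℝ) ^ k)) (QsE P k) (WstepLam P k Λ'₀)) ∧
      0 < BIJ85UnitPropagator433.unitZ (WstepLam P k Λ'₀)
        (deltaOp (V411 P k) (curlOp (P := P) (P.eta k ^ P.d) ((P.L : ℝ) ^ k)) (QsE P k)) :=
  BIJ85UnitPropagator433.isUnitPropagator_unitPropagator _ _ _ _ fun w hw => noZeroModes_stepLam hd hk w hw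

/-- **`C^{(k)}_ΛJ` is localized in `Λ`** (and lies in `δ(QB)δ_{Ax}(B)`): the propagator with Dirichlet boundary conditions maps into `Wstep_Λ`.
[cite: BalabanImbrieJaffe1985, (4.3.3) p.311] -/
theorem unitPropagator_stepLam_mem (w c : ℝ) (J : CoarseSpace P k) :
    unitPropagator (V411 P k) (curlOp (P := P) w c) (QsE P k) (WstepLam P k Λ'₀) J ∈ WstepLam P k Λ'₀ :=
  BIJ85Ineq434Proof.axialPropagator_mem _ _ J

/-- the kernel of file 6's corner-gauge propagator with Dirichlet boundary conditions as a matrix, `K_Λ(a, a′) = (C_{W_Λ}δ_{a′})(a)`.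
[cite: BalabanImbrieJaffe1985, (4.3.5) p.311] -/
def KcornerLam (P : Params) (k : ℕ) [DecidableEq (PBond P k)] (Λ'₀ : Finset (Fin P.d → ℤ)) : Matrix (PBond P k) (PBond P k) ℝ :=
  Matrix.of fun a a' => unitPropagator (V411 P k) (curlOp (P := P) (P.eta k ^ P.d) ((P.L : ℝ) ^ k)) (QsE P k) (WcornerLam P k Λ'₀)
    (EuclideanSpace.single a' 1) a

/-- unfolding `KcornerLam`. [cite: BalabanImbrieJaffe1985, (4.3.5) p.311] -/
theorem KcornerLam_apply [DecidableEq (PBond P k)] (a a' : PBond P k) :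
    KcornerLam P k Λ'₀ a a' = unitPropagator (V411 P k) (curlOp (P := P) (P.eta k ^ P.d) ((P.L : ℝ) ^ k)) (QsE P k) (WcornerLam P k Λ'₀)
      (EuclideanSpace.single a' 1) a := rfl

/-- **THE KERNEL OF `C^{(k)}_Λ` ON `Wstep_Λ` IS `T̂ · C_{W_Λ} · T̂ᵀ`** (file 3's Galerkin transport `kernel_transport` between the two Λ-slices:
`∂H_{k,Ax}T̂ = ∂H_{k,Ax}`, `T̂(W_Λ) ⊆ Wstep_Λ` onto, no zero modes on `W_Λ`); `d ≥ 2`, `k + 1 ≤ m + K`, every `Λ′₀`.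
[cite: BalabanImbrieJaffe1985, (4.3.5) p.311; Balaban1984PropagatorsII, (2.156) p.250] -/
theorem kernel_stepLam_eq [DecidableEq (PBond P k)] (hd : 2 ≤ P.d) (hk : k + 1 ≤ P.m + P.K) (b b' : PBond P k) :
    unitPropagator (V411 P k) (curlOp (P := P) (P.eta k ^ P.d) ((P.L : ℝ) ^ k)) (QsE P k) (WstepLam P k Λ'₀)
        (EuclideanSpace.single b' 1) b =
      (regaugeMat P k * KcornerLam P k Λ'₀ * (regaugeMat P k)ᵀ) b b' := by
  unfold KcornerLam BIJ85Ineq723Torus.regaugeMat unitPropagator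
  exact kernel_transport (W₁ := WstepLam P k Λ'₀) (W₂ := WcornerLam P k Λ'₀) (regauge P k)
    (fun w hw => noZeroModes_cornerLam hd hk w hw)
    (fun x => by
      simp only [LinearMap.comp_apply]
      exact curlHop_regauge (by omega) (eta_pow_pos P k P.d) (Lpow_ne_zero P k) x)
    (fun w => regauge_mem_WstepLam hk w) (fun w => exists_regauge_eq_lam hk w) b b'

/-! ## §4  (7.2.3) WITH DIRICHLET BOUNDARY CONDITIONS OUTSIDE Λ, UNIFORMLY IN Λ, FOR THE (4.3.3) PROPAGATOR OF RECORD — NO HYPOTHESIS -/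

/-- triangle inequality for `supDist` (through pub-balaban's torus distance `T`). [folklore] -/
private theorem supDist_triangle_real (x y z : Balaban1983to89.Site P k) :
    (supDist x z : ℝ) ≤ (supDist x y : ℝ) + (supDist y z : ℝ) := by
  rw [← B3Bound323ZeroTorus.T_eq_supDist, ← B3Bound323ZeroTorus.T_eq_supDist, ← B3Bound323ZeroTorus.T_eq_supDist]
  exact B5Ineq137Torus.T_triangle P k x y z

/-- the bonds of `T₁^{(k)}` with the `ℓ^∞` torus distance of their sources as a pseudo-metric space (inside proofs only, to apply the pub-balaban
sandwich lemma `B6FromB4.sandwich_decay`; file 3 keeps its copy private). [folklore] -/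
@[reducible] private def bondPMS (P : Params) (k : ℕ) : PseudoMetricSpace (PBond P k) where
  dist b b' := (supDist b.src b'.src : ℝ)
  dist_self b := by
    show (supDist b.src b.src : ℝ) = 0
    rw [(B3TorusRadialSums.supDist_eq_zero_iff _ _).2 rfl, Nat.cast_zero]
  dist_comm b b' := by
    show (supDist b.src b'.src : ℝ) = (supDist b'.src b.src : ℝ)
    rw [B3TorusRadialSums.supDist_comm]
  dist_triangle b b' b'' := supDist_triangle_real _ _ _

/-- **(7.2.3), SECOND SENTENCE, FOR THE (4.3.3) PROPAGATOR OF RECORD, WITH NO HYPOTHESIS** — p. 325 [PDF 27], verbatim: *"The unit lattice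
propagator C^{(k)} also has exponential decay, |C^{(k)}_{μν}(x, y)| ≤ Me^{−δ|x−y|}, (7.2.3) for x, y ∈ T₁^{(k)}. … In fact this inequality also holds
for propagators with Dirichlet boundary conditions outside a domain Λ, uniformly in Λ."* — there are `M, δ > 0` DEPENDING ON `d` AND `L` ONLY such
that for every torus `Setup` with these `d ≥ 2`, `L`, every scale `k + 1 ≤ m + K`, EVERY finite set of block corners `Λ′₀` (selecting `Λ = B(Λ′₀)`),
and all bonds, `|C^{(k)}_Λ(b, b′)| ≤ Me^{−δ·supDist(b₋, b′₋)}` for `C^{(k)}_Λ = unitPropagator (V411 P k) (curlOp (η^d) (L^k)) (QsE P k) (WstepLam P k Λ′₀)`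
— the (4.3.3) Gaussian of the ACTUAL Δ_k of (4.3.1) over the fields of the series' V1 constraint subspace `δ(QB)δ_{Ax}(B)` (`Wstep`, CENTRED blocks)
that vanish on the bonds not meeting `Λ`.  Chain, all proved: file 6's `ineq723_corner_dirichlet` (Bałaban's corner gauge; (2.153)/(2.156) on Λ and
Sect. 5 of [7] inside, uniform in Λ) → `kernel_stepLam_eq` (`C_{Wstep_Λ} = T̂C_{W_Λ}T̂ᵀ`) → the locality and row sums of `T̂` (file 3 §5, INDEPENDENT of
Λ) and the pub-balaban sandwich lemma `B6FromB4.sandwich_decay`; `M = M₂e^{2δ₂L}(rowBound d L)²`, `δ = δ₂`, the SAME for all Λ.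
[cite: BalabanImbrieJaffe1985, (7.2.3) p.325] -/
theorem ineq723_step_dirichlet (d L : ℕ) (hd : 2 ≤ d) :
    ∃ M δ : ℝ, 0 < M ∧ 0 < δ ∧ ∀ (P : Params), P.d = d → P.L = L → ∀ (k : ℕ) (_ : DecidableEq (PBond P k)),
      k + 1 ≤ P.m + P.K → ∀ (Λ'₀ : Finset (Fin P.d → ℤ)) (b b' : PBond P k),
        |unitPropagator (V411 P k) (curlOp (P := P) (P.eta k ^ P.d) ((P.L : ℝ) ^ k)) (QsE P k) (WstepLam P k Λ'₀)
            (EuclideanSpace.single b' 1) b| ≤ M * Real.exp (-(δ * (supDist b.src b'.src : ℝ))) := by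
  obtain ⟨M₂, δ₂, hM, hδ, H⟩ := ineq723_corner_dirichlet d L hd
  refine ⟨M₂ * Real.exp (2 * δ₂ * L) * rowBound d L * rowBound d L, δ₂,
    by have := rowBound_pos d L; positivity, hδ, fun P hP hPL k _ hk Λ'₀ b b' => ?_⟩
  subst hP hPL
  rw [kernel_stepLam_eq hd hk]
  letI : PseudoMetricSpace (PBond P k) := bondPMS P k
  have hdist : ∀ a a' : PBond P k, dist a a' = (supDist a.src a'.src : ℝ) := fun _ _ => rfl
  have hD : ∀ a a' : PBond P k, |KcornerLam P k Λ'₀ a a'| ≤ M₂ * Real.exp (-(δ₂ * dist a a')) := fun a a' => by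
    rw [hdist, KcornerLam_apply]
    exact H P rfl rfl k _ hk Λ'₀ a a'
  have hrange : ∀ i u : PBond P k, regaugeMat P k i u ≠ 0 → dist i u ≤ (P.L : ℝ) := fun i u h => by
    rw [hdist]
    exact_mod_cast supDist_le_of_regaugeMat_ne_zero hk h
  have hrange' : ∀ v j : PBond P k, (regaugeMat P k)ᵀ v j ≠ 0 → dist v j ≤ (P.L : ℝ) := fun v j h => by
    rw [dist_comm]
    exact hrange j v h
  have hrow : ∀ i : PBond P k, ∑ u, |regaugeMat P k i u| ≤ rowBound P.d P.L := fun i => regaugeMat_row_le hk i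
  have hcol : ∀ j : PBond P k, ∑ v, |(regaugeMat P k)ᵀ v j| ≤ rowBound P.d P.L := fun j => by
    simp only [Matrix.transpose_apply]
    exact hrow j
  have h := B6FromB4.sandwich_decay (fun a : PBond P k => a) (fun a : PBond P k => a) (regaugeMat P k) (KcornerLam P k Λ'₀)
    (regaugeMat P k)ᵀ hM.le hδ.le hrange hrow hrange' hcol hD b b'
  rw [hdist] at h
  exact h

/-- **(7.2.3) WITH DIRICHLET BOUNDARY CONDITIONS AND (7.2.3) ON THE WHOLE TORUS WITH ONE PAIR OF CONSTANTS**: the `(M, δ)` of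
`ineq723_step_dirichlet` serve EVERY `Λ′₀` and, at `Λ ⊇ T₁^{(k)}` (`WstepLam_eq_Wstep`), file 3's torus propagator on `Wstep` — «uniformly in Λ»
including the periodic case. [cite: BalabanImbrieJaffe1985, (7.2.3) p.325] -/
theorem ineq723_step_dirichlet_and_torus (d L : ℕ) (hd : 2 ≤ d) :
    ∃ M δ : ℝ, 0 < M ∧ 0 < δ ∧ ∀ (P : Params), P.d = d → P.L = L → ∀ (k : ℕ) (_ : DecidableEq (PBond P k)),
      k + 1 ≤ P.m + P.K → ∀ (b b' : PBond P k),
        (∀ Λ'₀ : Finset (Fin P.d → ℤ),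
          |unitPropagator (V411 P k) (curlOp (P := P) (P.eta k ^ P.d) ((P.L : ℝ) ^ k)) (QsE P k) (WstepLam P k Λ'₀)
              (EuclideanSpace.single b' 1) b| ≤ M * Real.exp (-(δ * (supDist b.src b'.src : ℝ)))) ∧
        |unitPropagator (V411 P k) (curlOp (P := P) (P.eta k ^ P.d) ((P.L : ℝ) ^ k)) (QsE P k) (Wstep P k)
            (EuclideanSpace.single b' 1) b| ≤ M * Real.exp (-(δ * (supDist b.src b'.src : ℝ))) := by
  obtain ⟨M, δ, hM, hδ, H⟩ := ineq723_step_dirichlet d L hd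
  refine ⟨M, δ, hM, hδ, fun P hP hPL k _ hk b b' => ⟨fun Λ'₀ => H P hP hPL k _ hk Λ'₀ b b', ?_⟩⟩
  have hall : ∀ x : Balaban1983to89.Site P k, cornerOf x ∈ (Finset.univ.image fun z : Balaban1983to89.Site P k => cornerOf z) :=
    fun x => Finset.mem_image.2 ⟨x, Finset.mem_univ _, rfl⟩
  rw [← WstepLam_eq_Wstep hall]
  exact H P hP hPL k _ hk _ b b'

/-! ## §5  (2.153) and (4.3.4) WITH DIRICHLET BOUNDARY CONDITIONS OUTSIDE Λ ON `Wstep_Λ`, UNIFORMLY IN Λ — NO HYPOTHESIS (v1.1) -/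

/-- **(2.153) ON `Wstep_Λ`** in the shape `γ‖B‖² ≤ ‖∂H_{k,Ax}B‖²`, `γ = γ₁/R²` (`γ₁ = (1/12d²)L^{−d−1}`, `R = rowBound d L`): p09's `coercive_step'` on
`Wstep` restricted to the Λ-slice; the SAME `γ` for every `Λ′₀` (`d ≥ 2`, `k + 1 ≤ m + K`). [cite: Balaban1984PropagatorsII, (2.153) p.249] -/
theorem coercive_stepLam' (hd : 2 ≤ P.d) (hk : k + 1 ≤ P.m + P.K) (w : WstepLam P k Λ'₀) :
    gamma2153one P.d P.L / rowBound P.d P.L ^ 2 * ‖(w : CoarseSpace P k)‖ ^ 2 ≤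
      ‖(curlOp (P := P) (P.eta k ^ P.d) ((P.L : ℝ) ^ k) ∘ₗ
        Hop (V411 P k) (curlOp (P := P) (P.eta k ^ P.d) ((P.L : ℝ) ^ k)) (QsE P k)) (w : CoarseSpace P k)‖ ^ 2 :=
  coercive_step' hd hk ⟨(w : CoarseSpace P k), WstepLam_le w.2⟩

/-- **(2.153) ON `Wstep_Λ`**: `(γ₁/R²)‖B‖² ≤ ⟨B, Δ_kB⟩` for the (4.3.1) action operator, every `B ∈ Wstep_Λ`, every `Λ′₀`, no hypothesis.
[cite: Balaban1984PropagatorsII, (2.153) p.249] -/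
theorem coercive_stepLam (hd : 2 ≤ P.d) (hk : k + 1 ≤ P.m + P.K) (w : WstepLam P k Λ'₀) :
    gamma2153one P.d P.L / rowBound P.d P.L ^ 2 * ‖(w : CoarseSpace P k)‖ ^ 2 ≤
      ⟪(w : CoarseSpace P k), deltaOp (V411 P k) (curlOp (P := P) (P.eta k ^ P.d) ((P.L : ℝ) ^ k)) (QsE P k)
        (w : CoarseSpace P k)⟫ :=
  (BIJ85Ineq434Proof.coercive_iff _ _ _ _ _).2 (fun w => coercive_stepLam' hd hk w) w

/-- **(4.3.4) WITH DIRICHLET BOUNDARY CONDITIONS OUTSIDE `Λ`, UNIFORMLY IN `Λ`, FOR THE PROPAGATOR OF RECORD, NO HYPOTHESIS** — p. 311: *"C^{(k)} is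
well defined and is bounded in norm ‖C^{(k)}‖ ≤ c (4.3.4) uniformly in k"*: `‖C^{(k)}_ΛJ‖ ≤ (R²/γ₁)‖J‖` and `0 ≤ ⟨J, C^{(k)}_ΛJ⟩ ≤ (R²/γ₁)‖J‖²` for
`C^{(k)}_Λ = unitPropagator … (WstepLam P k Λ′₀)`, every `k + 1 ≤ m + K`, EVERY `Λ′₀` — one `c = R²/γ₁` from `(d, L)` (p09's `ineq434_const`:
`12d²L^{d+1}·rowBound²`). [cite: BalabanImbrieJaffe1985, (4.3.4) p.311, (7.2.3) p.325] -/
theorem norm_unitPropagator_stepLam_le (hd : 2 ≤ P.d) (hk : k + 1 ≤ P.m + P.K) (J : CoarseSpace P k) :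
    ‖unitPropagator (V411 P k) (curlOp (P := P) (P.eta k ^ P.d) ((P.L : ℝ) ^ k)) (QsE P k) (WstepLam P k Λ'₀) J‖ ≤
        (gamma2153one P.d P.L / rowBound P.d P.L ^ 2)⁻¹ * ‖J‖ ∧
      0 ≤ ⟪J, unitPropagator (V411 P k) (curlOp (P := P) (P.eta k ^ P.d) ((P.L : ℝ) ^ k)) (QsE P k) (WstepLam P k Λ'₀) J⟫ ∧
      ⟪J, unitPropagator (V411 P k) (curlOp (P := P) (P.eta k ^ P.d) ((P.L : ℝ) ^ k)) (QsE P k) (WstepLam P k Λ'₀) J⟫ ≤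
        (gamma2153one P.d P.L / rowBound P.d P.L ^ 2)⁻¹ * ‖J‖ ^ 2 :=
  BIJ85Ineq434Proof.norm_unitPropagator_le _ _ _ _
    (div_pos (gamma2153one_pos (d := P.d) (by omega) P.L_pos) (pow_pos (rowBound_pos P.d P.L) 2)) (coercive_stepLam hd hk) J

/-- **`‖C^{(k)}_Λ‖ ≤ c`** as an operator-norm bound, the same `c` for every `Λ′₀`. [cite: BalabanImbrieJaffe1985, (4.3.4) p.311] -/
theorem opNorm_unitPropagator_stepLam_le (hd : 2 ≤ P.d) (hk : k + 1 ≤ P.m + P.K) :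
    ‖LinearMap.toContinuousLinearMap
        (unitPropagator (V411 P k) (curlOp (P := P) (P.eta k ^ P.d) ((P.L : ℝ) ^ k)) (QsE P k) (WstepLam P k Λ'₀))‖ ≤
      (gamma2153one P.d P.L / rowBound P.d P.L ^ 2)⁻¹ :=
  ContinuousLinearMap.opNorm_le_bound _
    (by have := rowBound_pos P.d P.L; have := gamma2153one_pos (d := P.d) (by omega) P.L_pos; positivity)
    fun J => by
      rw [LinearMap.coe_toContinuousLinearMap']
      exact (norm_unitPropagator_stepLam_le hd hk J).1

end

end Literature.MathematicalPhysics.QuantumFieldTheory.BalabanImbrieJaffe1984to88.BIJ85Ineq723TorusDirichletStep
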